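import Mathlib
import HarnessLib

/-!
# Coercivity of the transverse Hessian FROM QUADRATIC GROWTH — the bridge from pointwise growth bounds (chartBox-type) to the `hcoer` hypothesis of the
# quantitative Morse–Bott ∕ fibred Laplace method (free-hands support of ⟨stmt-QuantumFields-24197⟩; generic, Mathlib-only)

w2 g58's ✓`QuantitativeLaplace.laplaceMethod_quantitative_fibred_of_taylor` (the line of record for the window-uniform hearts of ⟨24197⟩/⟨24196⟩, LEAD g97 15:35Z)
takes, per fibre `p`, a symmetric `A p` with UNIFORM COERCIVITY `hcoer : λ‖y‖² ≤ ⟪A p y, y⟫` and an EXISTENTIAL Taylor datum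
`∃ τ odd, |f(p,y) − ½⟪A p y, y⟫ − τ y| ≤ B₄‖y‖⁴` on `‖y‖ ≤ R`.  On the model side the cheap, window-uniform information is QUADRATIC GROWTH of the deficit away from
the flat set (w2 g57's global ✓`BlowUpRing.chartBox_of_chartDeficit`: `‖U_i − 1‖_F ≤ 48L³√F̂`, `‖σ-relations‖_F ≤ 60L³√F̂`, poly(L), hub-angle independent), not a
spectral bound on a Hessian.  This file is the derivative-free bridge:

* ★★ `inner_ge_of_growth_of_taylor` — if `μ‖y‖² ≤ f y` on `‖y‖ ≤ R` and the Taylor datum holds (τ ODD; no bound on τ, no sign on B₄ needed), then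
  `2μ‖y‖² ≤ ⟪A y, y⟫` for EVERY `y` (average the datum at `ty` and `−ty` — oddness kills τ —, use growth, divide by `t²`, let `t → 0⁺`);
* ★ `inner_ge_of_growth_of_taylor_family` — the fibred form producing `hcoer` verbatim for a family `A : M → V →ₗ[ℝ] V`;
* ★★ `inner_ge_of_growth_of_taylor_offset` — the same at a NON-critical expansion point (constant `f₀` and any odd part in the datum):
  `(2μ − 2f₀/R² − 2B₄R²)‖y‖² ≤ ⟪A y, y⟫` — uniform follower coercivity at `U ≡ 1` over all near-flat leaders, no Hessian-Lipschitz step;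
* ★ `inner_ge_sub_of_abs_inner_sub_le` — coercivity transfer `λ ↦ λ − δ` under a form perturbation `|⟪A′y,y⟫ − ⟪Ay,y⟫| ≤ δ‖y‖²` (near-flat base points, where
  growth is only known at the nearby flat point; companion of w2 g58's ✓`abs_log_det_sub_log_det_le`).
So `hcoer` with `λ = 2μ − δ` follows from (growth at flat points, poly(L)) + (the J-jets' Hessian-Lipschitz δ on a `1/poly(L)` ball) — no eigenvalue problem for the
`6L⁴−3` follower block is ever posed.

HONEST LABEL: elementary real analysis; nothing model-side; ⟨24197⟩ ∕ ⟨24196⟩ ∕ ⟨24194⟩ ∕ ⟨24497⟩ OPEN; own crux ⟨22884⟩ OPEN (blocked-on ⟨19935⟩); the Yang–Mills mass gap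
is NOT proved; no summit is proved by a line.  THEOREMS ONLY (0 `def`, 0 `sorry`), standard axioms.  Width seat ym-line-sfw-p2-w3 g65 (cell ym-idea-1, free hands),
`--supports stmt-QuantumFields-24197`.  References: [folklore].
-/

set_option autoImplicit false

noncomputable section

open _root_.Filter _root_.Set _root_.Metric
open scoped _root_.Topology _root_.Real _root_.InnerProductSpace

namespace Summit.QuantumFields.YangMills.Theorems.QuantitativeLaplace

variable {V : Type*} [NormedAddCommGroup V] [InnerProductSpace ℝ V]

/-- ★★ **COERCIVITY FROM GROWTH**: let `A : V →ₗ[ℝ] V`, `f : V → ℝ`, `R > 0`.  If `μ‖y‖² ≤ f y` for `‖y‖ ≤ R` (quadratic growth from the minimum value `0`)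
and the Taylor datum of ✓`laplaceMethod_quantitative_fibred_of_taylor` holds — `∃ τ` ODD with `|f y − ½⟪A y, y⟫ − τ y| ≤ B₄‖y‖⁴` for `‖y‖ ≤ R` — then
`2μ‖y‖² ≤ ⟪A y, y⟫` for EVERY `y`.  (At `ty` and `−ty` the odd parts cancel: `2μt²‖y‖² ≤ f(ty) + f(−ty) ≤ t²⟪Ay,y⟫ + 2B₄t⁴‖y‖⁴`; divide by `t²`, `t → 0⁺`.)
[folklore] -/
theorem inner_ge_of_growth_of_taylor {A : V →ₗ[ℝ] V} {f : V → ℝ} {μ B₄ R : ℝ} (hR : 0 < R)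
    (hgrowth : ∀ y : V, ‖y‖ ≤ R → μ * ‖y‖ ^ 2 ≤ f y)
    (hT : ∃ τ : V → ℝ, (∀ y, τ (-y) = -τ y) ∧ ∀ y : V, ‖y‖ ≤ R → |f y - (1 / 2) * ⟪A y, y⟫_ℝ - τ y| ≤ B₄ * ‖y‖ ^ 4)
    (y : V) : 2 * μ * ‖y‖ ^ 2 ≤ ⟪A y, y⟫_ℝ := by
  obtain ⟨τ, hτ, hrem⟩ := hT
  by_cases hy : y = 0
  · subst hy; simp
  have hy0 : 0 < ‖y‖ := norm_pos_iff.2 hy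
  -- for `0 < t ≤ R/‖y‖`: `2μ‖y‖² ≤ ⟪Ay,y⟫ + 2 B₄ t² ‖y‖⁴`
  have key : ∀ t : ℝ, 0 < t → t ≤ R / ‖y‖ → 2 * μ * ‖y‖ ^ 2 ≤ ⟪A y, y⟫_ℝ + 2 * B₄ * t ^ 2 * ‖y‖ ^ 4 := by
    intro t ht htR
    have hty : ‖t • y‖ ≤ R := by
      rw [norm_smul, Real.norm_eq_abs, abs_of_pos ht]; rwa [le_div_iff₀ hy0] at htR
    have hty' : ‖-(t • y)‖ ≤ R := by rwa [norm_neg]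
    have h1 := hrem (t • y) hty
    have h2 := hrem (-(t • y)) hty'
    have g1 := hgrowth (t • y) hty
    have g2 := hgrowth (-(t • y)) hty'
    rw [hτ] at h2
    have e1 : ⟪A (t • y), t • y⟫_ℝ = t ^ 2 * ⟪A y, y⟫_ℝ := by
      rw [map_smul, inner_smul_left, inner_smul_right]; simp; ring
    have e2 : ⟪A (-(t • y)), -(t • y)⟫_ℝ = t ^ 2 * ⟪A y, y⟫_ℝ := by rw [map_neg, inner_neg_neg, e1]
    have en : ‖t • y‖ = t * ‖y‖ := by rw [norm_smul, Real.norm_eq_abs, abs_of_pos ht]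
    have en' : ‖-(t • y)‖ = t * ‖y‖ := by rw [norm_neg, en]
    rw [e1, en] at h1
    rw [e2, en'] at h2
    rw [en] at g1
    rw [en'] at g2
    have s1 := (abs_le.1 h1).2
    have s2 := (abs_le.1 h2).2
    -- `2μ t²‖y‖² ≤ t²⟪Ay,y⟫ + 2B₄ t⁴ ‖y‖⁴`, then divide by `t² > 0`
    have ht2 : 0 < t ^ 2 := by positivity
    have hsum : 2 * μ * (t * ‖y‖) ^ 2 ≤ t ^ 2 * ⟪A y, y⟫_ℝ + 2 * B₄ * (t * ‖y‖) ^ 4 := by nlinarith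
    have : t ^ 2 * (2 * μ * ‖y‖ ^ 2) ≤ t ^ 2 * (⟪A y, y⟫_ℝ + 2 * B₄ * t ^ 2 * ‖y‖ ^ 4) := by nlinarith
    exact le_of_mul_le_mul_left this ht2
  -- let `t → 0⁺`
  have hlim : Tendsto (fun t : ℝ => ⟪A y, y⟫_ℝ + 2 * B₄ * t ^ 2 * ‖y‖ ^ 4) (𝓝[>] 0) (𝓝 (⟪A y, y⟫_ℝ + 2 * B₄ * 0 ^ 2 * ‖y‖ ^ 4)) := by
    have hc : Continuous fun t : ℝ => ⟪A y, y⟫_ℝ + 2 * B₄ * t ^ 2 * ‖y‖ ^ 4 := by continuity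
    exact (hc.tendsto 0).mono_left nhdsWithin_le_nhds
  simp only [ne_eq, OfNat.ofNat_ne_zero, not_false_eq_true, zero_pow, mul_zero, zero_mul, add_zero] at hlim
  refine ge_of_tendsto hlim ?_
  have hpos : 0 < R / ‖y‖ := div_pos hR hy0
  filter_upwards [Ioc_mem_nhdsGT hpos] with t ht
  exact key t ht.1 ht.2

/-- ★ **The fibred form**: a family version producing the `hcoer` hypothesis of ✓`laplaceMethod_quantitative_fibred_of_taylor` verbatim from uniform growth and
the same family Taylor datum `hfT` (its bound on `τ` is not used). [folklore] -/
theorem inner_ge_of_growth_of_taylor_family {M : Type*} {A : M → V →ₗ[ℝ] V} {f : M × V → ℝ} {μ B₃ B₄ R : ℝ} (hR : 0 < R)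
    (hgrowth : ∀ (p : M) (y : V), ‖y‖ ≤ R → μ * ‖y‖ ^ 2 ≤ f (p, y))
    (hfT : ∀ p, ∃ τ : V → ℝ, (∀ y, τ (-y) = -τ y) ∧ (∀ y : V, ‖y‖ ≤ R → |τ y| ≤ B₃ * ‖y‖ ^ 3) ∧
      ∀ y : V, ‖y‖ ≤ R → |f (p, y) - (1 / 2) * ⟪A p y, y⟫_ℝ - τ y| ≤ B₄ * ‖y‖ ^ 4) :
    ∀ (p : M) (y : V), 2 * μ * ‖y‖ ^ 2 ≤ ⟪A p y, y⟫_ℝ := fun p y => by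
  obtain ⟨τ, hτo, -, hrem⟩ := hfT p
  exact inner_ge_of_growth_of_taylor (A := A p) (f := fun y => f (p, y)) hR (fun y hy => hgrowth p y hy) ⟨τ, hτo, hrem⟩ y

/-- ★ **Coercivity transfer under a form perturbation**: `λ‖y‖² ≤ ⟪Ay,y⟫` and `|⟪A′y,y⟫ − ⟪Ay,y⟫| ≤ δ‖y‖²` give `(λ − δ)‖y‖² ≤ ⟪A′y,y⟫` (near-flat base points;
companion of ✓`abs_log_det_sub_log_det_le`). [folklore] -/
theorem inner_ge_sub_of_abs_inner_sub_le {A A' : V →ₗ[ℝ] V} {lam δ : ℝ} (hA : ∀ y : V, lam * ‖y‖ ^ 2 ≤ ⟪A y, y⟫_ℝ)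
    (hδ : ∀ y : V, |⟪A' y, y⟫_ℝ - ⟪A y, y⟫_ℝ| ≤ δ * ‖y‖ ^ 2) (y : V) : (lam - δ) * ‖y‖ ^ 2 ≤ ⟪A' y, y⟫_ℝ := by
  have h1 := hA y
  have h2 := (abs_le.1 (hδ y)).1
  nlinarith


/-- ★★ **COERCIVITY FROM ABSOLUTE GROWTH AT A NON-CRITICAL EXPANSION POINT** (near-flat base points): let `μ‖y‖² ≤ f y` on `‖y‖ ≤ R` (an ABSOLUTE quadratic lower
bound — e.g. ✓`BlowUpRing.sum_follower_frobNorm_sq_le_chartDeficit`, valid at EVERY leader tuple) and let the Taylor datum at the expansion point carry a CONSTANT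
`f₀` (the value there, not assumed minimal) and an arbitrary ODD part `σ` (linear + cubic): `|f y − f₀ − ½⟪A y, y⟫ − σ y| ≤ B₄‖y‖⁴`.  Then for EVERY `y`
`(2μ − 2f₀/R² − 2B₄R²)·‖y‖² ≤ ⟪A y, y⟫`
(evaluate at `±u`, `‖u‖ = R`, add, rescale by homogeneity).  With `R² = μ/(4B₄)` and `f₀ ≤ μ²/(16B₄)` the constant is `≥ μ`: the follower Hessian at `U ≡ 1` is
uniformly coercive over ALL leaders whose thin-toron energy `F̂(C,1)` is `≤ μ²/(16B₄) = 1/poly(L)` — no Hessian-Lipschitz step. [folklore] -/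
theorem inner_ge_of_growth_of_taylor_offset {A : V →ₗ[ℝ] V} {f : V → ℝ} {μ B₄ R f₀ : ℝ} (hR : 0 < R)
    (hgrowth : ∀ y : V, ‖y‖ ≤ R → μ * ‖y‖ ^ 2 ≤ f y)
    (hT : ∃ σ : V → ℝ, (∀ y, σ (-y) = -σ y) ∧ ∀ y : V, ‖y‖ ≤ R → |f y - f₀ - (1 / 2) * ⟪A y, y⟫_ℝ - σ y| ≤ B₄ * ‖y‖ ^ 4)
    (y : V) : (2 * μ - 2 * f₀ / R ^ 2 - 2 * B₄ * R ^ 2) * ‖y‖ ^ 2 ≤ ⟪A y, y⟫_ℝ := by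
  obtain ⟨σ, hσ, hrem⟩ := hT
  by_cases hy : y = 0
  · subst hy; simp
  have hy0 : 0 < ‖y‖ := norm_pos_iff.2 hy
  -- the rescaled vector `u = (R/‖y‖) • y` of norm `R`
  set t : ℝ := R / ‖y‖ with ht
  have ht0 : 0 < t := div_pos hR hy0
  have hnu : ‖t • y‖ = R := by
    rw [norm_smul, Real.norm_eq_abs, abs_of_pos ht0, ht, div_mul_cancel₀ _ hy0.ne']
  have hnu' : ‖-(t • y)‖ = R := by rw [norm_neg, hnu]
  have h1 := hrem (t • y) hnu.le
  have h2 := hrem (-(t • y)) hnu'.le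
  have g1 := hgrowth (t • y) hnu.le
  have g2 := hgrowth (-(t • y)) hnu'.le
  rw [hσ] at h2
  have e1 : ⟪A (t • y), t • y⟫_ℝ = t ^ 2 * ⟪A y, y⟫_ℝ := by
    rw [map_smul, inner_smul_left, inner_smul_right]; simp; ring
  have e2 : ⟪A (-(t • y)), -(t • y)⟫_ℝ = t ^ 2 * ⟪A y, y⟫_ℝ := by rw [map_neg, inner_neg_neg, e1]
  rw [e1, hnu] at h1
  rw [e2, hnu'] at h2
  rw [hnu] at g1
  rw [hnu'] at g2
  have s1 := (abs_le.1 h1).2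
  have s2 := (abs_le.1 h2).2
  -- `2μR² ≤ 2f₀ + t²⟪Ay,y⟫ + 2B₄R⁴`
  have hsum : 2 * μ * R ^ 2 ≤ 2 * f₀ + t ^ 2 * ⟪A y, y⟫_ℝ + 2 * B₄ * R ^ 4 := by linarith
  -- rescale: `t² ‖y‖² = R²`
  have hty : t ^ 2 * ‖y‖ ^ 2 = R ^ 2 := by rw [← mul_pow, ← hnu, norm_smul, Real.norm_eq_abs, abs_of_pos ht0]
  have hR2 : 0 < R ^ 2 := by positivity
  -- multiply the target by `t²` (positive) and compare
  have key : t ^ 2 * ((2 * μ - 2 * f₀ / R ^ 2 - 2 * B₄ * R ^ 2) * ‖y‖ ^ 2) ≤ t ^ 2 * ⟪A y, y⟫_ℝ := by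
    have e : t ^ 2 * ((2 * μ - 2 * f₀ / R ^ 2 - 2 * B₄ * R ^ 2) * ‖y‖ ^ 2) =
        (2 * μ - 2 * f₀ / R ^ 2 - 2 * B₄ * R ^ 2) * R ^ 2 := by rw [← hty]; ring
    rw [e]
    have e2 : (2 * μ - 2 * f₀ / R ^ 2 - 2 * B₄ * R ^ 2) * R ^ 2 = 2 * μ * R ^ 2 - 2 * f₀ - 2 * B₄ * R ^ 4 := by
      field_simp
    rw [e2]
    linarith
  exact le_of_mul_le_mul_left key (by positivity)

end Summit.QuantumFields.YangMills.Theorems.QuantitativeLaplace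

end
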